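import Summits.HodgeConjecture.HodgeConjecture.Theorems.VHCAbelianSchemesRoadTwistedDoorPrimeIsoRespects
import HarnessLib

/-!
# Negative knowledge for crux `SemiregularSheafRepresentativesTwPrimeAtDiag` (road b02, rung `(6, 3)`) — the PRIMED twisted door
# `AdmTw' := gluableSigmaAdmissible ∨ bfSingleAdmissible'` PINS THE SIDE CLASSES `κ₁, κ₂` of every datum with `3 ∈ I`, and is EMPTY at `I = {3}`

research route conditional on HC_CM; not a corollary; Q11.4-sentence-2 already refuted in dim ≥ 3.

Refuter lane (pub-hodge-ring2, seat `refute-markman`, gen 3; hostile read of the rank-0 design pass), FACT-FREE, by unfolding two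
definitions of record. A rank-0 design memo for the cell `(6, 3)` proposed to work in the σ-disjunct of the primed door with the index set
`I = {3}` («legal»), leaving `κ₁, κ₂` FREE so that the class problem is ONE congruence in degree 3. The tree letter says otherwise, and this
file records it as kernel-checked bookkeeping (nothing new is defined; `AdmTw'` is spelled inline exactly as in the route file):

* `not_isShiftedInitialSegment_singleton_three` — `{3}` is NOT a shifted initial segment (`3 ∈ I` forces `1, 2 ∈ I`), so the primed
  Buchweitz–Flenner disjunct `bfSingleAdmissible' n X₀ {3} E` is empty (`not_bfSingleAdmissible'_singleton_three`);
* `not_gluableSigmaAdmissible_of_not_mem` — the σ-disjunct's conjunct (i) `{1, …, n} ⊆ I` excludes every `I` missing some `1 ≤ p ≤ n`;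
  in particular `gluableSigmaAdmissible n X₀ {3} E` is empty for `n ≥ 1` (`not_gluableSigmaAdmissible_singleton_three`);
* `not_admTw'_singleton_three`, `not_twistedReflexiveClass_admTw'_singleton_three` — hence the primed door has NO member at all with
  `I = {3}` as soon as `n ≥ 1`, whatever the classes `κ` and the Chern character theory `C`;
* `icc_one_three_subset_of_twistedReflexiveClass_admTw'` — a member of the primed door with `3 ∈ I` and `3 ≤ n` has `{1, 2, 3} ⊆ I`
  (σ-disjunct: all of `{1, …, n}`; BF′-disjunct: the initial segment below `3`);
* `sideClasses_one_two_pinned_of_twistedReflexiveClass_admTw'` — consequently, in ANY datum `(I ∋ 3, κ, c)` of the anchored-carrier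
  shape `∀ q ∈ I, q ≠ 3 → κ_q = c_q • θ^q` (the pinned design of `AnchoredCarrierAt 𝒪 n 3 𝔄 𝔖`, `n ≥ 3`) over the primed door, the
  side classes `κ₁` AND `κ₂` lie on the `θ`-ray: they are NOT free. For the σ-disjunct at `n = 6` all of `κ₁, κ₂, κ₄, κ₅, κ₆` are pinned
  (`sideClasses_pinned_of_gluableSigmaAdmissible_six`).

So a rank-0 σ-door design at `(6, 3)` is the FULL pinned class problem (five ray conditions and one Weil slot on `exp(B₀) ∪ ch(E•)`), not a
single congruence; e.g. the `μ₃`-twisted Poincaré K-class `Σ_{φ ∈ μ₃} [L_φ] − 3[𝒪]` on `E³ × Ē³`, `E = ℂ/ℤ[ω]`, has `κ₂ = 3 ν ν̄ ∉ ℂ θ²`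
and fails the door at class level (refuter report REFUTE-MARKMAN-G3.md). Nothing here says any cell, carrier statement, K-SR♭∃, VHC,
`HC_AV` or HC holds or fails; `HC_CM` occurs nowhere; no statement of any item is touched.
References: [cite: BuchweitzFlenner2003, Def. 4.1 and §5 (I-semiregular)] [cite: Pridham2024Semiregularity, Rem. 2.26 with Cor. 2.25]
[cite: Bloch1972Semiregularity, Remark (7.5)].
-/

noncomputable section

open CategoryTheory CategoryTheory.Limits AlgebraicGeometry Topology
open AlgebraicGeometry.Scheme.Modules

namespace Summit.HodgeConjecture.HodgeConjecture.Ring2.SemiregularRepresentatives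

-- the cell's namespace repeats the summit name (`Summit.HodgeConjecture.HodgeConjecture…`), as in every `Ring2*` file
set_option linter.dupNamespace false

open Literature.AlgebraicGeometry Literature.AlgebraicGeometry.Motives Literature.AlgebraicGeometry.Modules
open Literature.AlgebraicGeometry.HodgeTheory
open Literature.AlgebraicGeometry.KTheory
open Literature.AlgebraicTopology.SingularHomology

/-! ### §1 The index set `{3}` is admitted by NEITHER disjunct of the primed door -/

/-- **`{3}` is not a shifted initial segment**: `2 + 1 ∈ {3}` but `0 + 1 ∉ {3}`. [cite: BuchweitzFlenner2003, §5 (I-semiregular)] -/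
theorem not_isShiftedInitialSegment_singleton_three : ¬ ({3} : Finset ℕ).IsShiftedInitialSegment := by
  intro h
  have h1 : 0 + 1 ∈ ({3} : Finset ℕ) := h 2 (by simp) 0 (Nat.zero_le 2)
  simp at h1

variable {n : ℕ} {X₀ : SchemeOver ℂ} {I : Finset ℕ} {E : CochainComplex X₀.left.Modules ℤ}

/-- **Conjunct (i) of the gluable σ-notion excludes every index set missing a degree `1 ≤ p ≤ n`.**
[cite: BuchweitzFlenner2003, §5 (I-semiregular)] -/
theorem not_gluableSigmaAdmissible_of_not_mem {p : ℕ} (hp1 : 1 ≤ p) (hpn : p ≤ n) (hp : p ∉ I) :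
    ¬ Summit.Ventures.HSemireg.gluableSigmaAdmissible n X₀ I E :=
  fun h => hp (h.1 p hp1 hpn)

/-- A gluable-σ-admissible datum has `{1, …, n} ⊆ I`. [cite: BuchweitzFlenner2003, §5 (I-semiregular)] -/
theorem icc_subset_of_gluableSigmaAdmissible (h : Summit.Ventures.HSemireg.gluableSigmaAdmissible n X₀ I E) :
    Finset.Icc 1 n ⊆ I :=
  fun p hp => h.1 p (Finset.mem_Icc.1 hp).1 (Finset.mem_Icc.1 hp).2

/-- **The σ-disjunct is EMPTY at `I = {3}` for every `n ≥ 1`** (`1 ∉ {3}`). [cite: BuchweitzFlenner2003, §5 (I-semiregular)] -/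
theorem not_gluableSigmaAdmissible_singleton_three (hn : 1 ≤ n) :
    ¬ Summit.Ventures.HSemireg.gluableSigmaAdmissible n X₀ {3} E :=
  not_gluableSigmaAdmissible_of_not_mem le_rfl hn (by simp)

/-- **The primed Buchweitz–Flenner disjunct is EMPTY at `I = {3}`** (for every `n`): its index conjunct fails.
[cite: BuchweitzFlenner2003, §5 (I-semiregular) and Thm. 5.1] [cite: Pridham2024Semiregularity, Rem. 2.26 with Cor. 2.25] -/
theorem not_bfSingleAdmissible'_singleton_three : ¬ bfSingleAdmissible' n X₀ {3} E :=
  fun h => not_isShiftedInitialSegment_singleton_three h.2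

/-- **The primed admissibility `AdmTw' := gluableSigmaAdmissible ∨ bfSingleAdmissible'` admits NO complex at `I = {3}`, `n ≥ 1`.**
[cite: BuchweitzFlenner2003, §5 (I-semiregular)] [cite: Pridham2024Semiregularity, Rem. 2.26 with Cor. 2.25] -/
theorem not_admTw'_singleton_three (hn : 1 ≤ n) :
    ¬ (Summit.Ventures.HSemireg.gluableSigmaAdmissible n X₀ {3} E ∨ bfSingleAdmissible' n X₀ {3} E) :=
  fun h => h.elim (not_gluableSigmaAdmissible_singleton_three hn) not_bfSingleAdmissible'_singleton_three

variable {C : ChernCharacterBetti} {κ : (p : ℕ) → complexBetti X₀ (2 * p)}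

/-- **The primed twisted door `twistedReflexiveClass C AdmTw'` has NO member with index set `{3}`** (`n ≥ 1`), whatever the classes `κ`
and the Chern character theory `C`: «`I = {3}` is legal» is false for the door of record.
[cite: BuchweitzFlenner2003, §5 (I-semiregular)] [cite: Pridham2024Semiregularity, Rem. 2.26 with Cor. 2.25] -/
theorem not_twistedReflexiveClass_admTw'_singleton_three (hn : 1 ≤ n) :
    ¬ Literature.AlgebraicGeometry.HodgeTheory.twistedReflexiveClass C
      (fun n X₀ I E => Summit.Ventures.HSemireg.gluableSigmaAdmissible n X₀ I E ∨
        Literature.AlgebraicGeometry.HodgeTheory.bfSingleAdmissible' n X₀ I E) n X₀ {3} κ := by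
  intro h
  rcases twistedReflexiveClass_admTw'_isShiftedInitialSegment_or h with hσ | hbf
  · exact absurd (hσ (Finset.mem_Icc.2 ⟨le_rfl, hn⟩)) (by simp)
  · exact not_isShiftedInitialSegment_singleton_three hbf

/-! ### §2 With `3 ∈ I` BOTH disjuncts force `{1, 2, 3} ⊆ I`, so the side classes `κ₁, κ₂` of a pinned datum are on the `θ`-ray -/

/-- A shifted initial segment containing `3` contains `{1, 2, 3}`. [cite: BuchweitzFlenner2003, §5 (I-semiregular)] -/
theorem icc_one_three_subset_of_isShiftedInitialSegment (hI : I.IsShiftedInitialSegment) (h3 : 3 ∈ I) :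
    Finset.Icc 1 3 ⊆ I := by
  intro p hp
  obtain ⟨hp1, hp3⟩ := Finset.mem_Icc.1 hp
  obtain ⟨q, rfl⟩ : ∃ q, p = q + 1 := ⟨p - 1, by omega⟩
  exact hI 2 h3 q (by omega)

/-- **A member of the primed door with `3 ∈ I` and `3 ≤ n` has `{1, 2, 3} ⊆ I`** — in the σ-disjunct because `{1, …, n} ⊆ I`, in the
primed BF disjunct because `{q | q + 1 ∈ I}` is an initial segment containing `2`.
[cite: BuchweitzFlenner2003, §5 (I-semiregular)] [cite: Pridham2024Semiregularity, Rem. 2.26 with Cor. 2.25] -/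
theorem icc_one_three_subset_of_twistedReflexiveClass_admTw' (hn : 3 ≤ n) (h3 : 3 ∈ I)
    (h : Literature.AlgebraicGeometry.HodgeTheory.twistedReflexiveClass C
      (fun n X₀ I E => Summit.Ventures.HSemireg.gluableSigmaAdmissible n X₀ I E ∨
        Literature.AlgebraicGeometry.HodgeTheory.bfSingleAdmissible' n X₀ I E) n X₀ I κ) :
    Finset.Icc 1 3 ⊆ I := by
  rcases twistedReflexiveClass_admTw'_isShiftedInitialSegment_or h with hσ | hbf
  · exact (Finset.Icc_subset_Icc_right hn).trans hσ
  · exact icc_one_three_subset_of_isShiftedInitialSegment hbf h3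

/-- **The side classes `κ₁` and `κ₂` of a pinned datum over the primed door are ON THE `θ`-RAY.** For every datum `(I ∋ 3, κ, c)` with
`κ` in the primed door at some `n ≥ 3` and the anchored-carrier side condition `∀ q ∈ I, q ≠ 3 → κ_q = c_q • θ^q` (the shape produced by
`AnchoredCarrierAt 𝒪 n 3 𝔄 𝔖`), one has `κ₁ = c₁ • θ` and `κ₂ = c₂ • θ²`: the degrees `1, 2` are NOT free, in either disjunct.
[cite: Bloch1972Semiregularity, Remark (7.5)] [cite: BuchweitzFlenner2003, §5 (I-semiregular)] -/
theorem sideClasses_one_two_pinned_of_twistedReflexiveClass_admTw' {θ : complexBetti X₀ 2} {c : ℕ → ℂ} (hn : 3 ≤ n)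
    (h3 : 3 ∈ I)
    (h : Literature.AlgebraicGeometry.HodgeTheory.twistedReflexiveClass C
      (fun n X₀ I E => Summit.Ventures.HSemireg.gluableSigmaAdmissible n X₀ I E ∨
        Literature.AlgebraicGeometry.HodgeTheory.bfSingleAdmissible' n X₀ I E) n X₀ I κ)
    (hside : ∀ q ∈ I, q ≠ 3 → κ q = c q • cupPowTwo θ q) :
    κ 1 = c 1 • cupPowTwo θ 1 ∧ κ 2 = c 2 • cupPowTwo θ 2 := by
  have hI := icc_one_three_subset_of_twistedReflexiveClass_admTw' hn h3 h
  exact ⟨hside 1 (hI (by simp)) (by decide), hside 2 (hI (by simp)) (by decide)⟩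

/-- **In the σ-disjunct at `n = 6` ALL side classes are pinned**: a gluable-σ-admissible complex `E` realising `κ` through the cell's side
condition `∀ q ∈ I, q ≠ 3 → κ_q = c_q • θ^q` has `κ_q = c_q • θ^q` for every `q ∈ {1, 2, 4, 5, 6}` — five ray conditions, not one
congruence. [cite: BuchweitzFlenner2003, §5 (I-semiregular)] [cite: Bloch1972Semiregularity, Remark (7.5)] -/
theorem sideClasses_pinned_of_gluableSigmaAdmissible_six {θ : complexBetti X₀ 2} {c : ℕ → ℂ}
    (h : Summit.Ventures.HSemireg.gluableSigmaAdmissible 6 X₀ I E) (hside : ∀ q ∈ I, q ≠ 3 → κ q = c q • cupPowTwo θ q)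
    {q : ℕ} (hq1 : 1 ≤ q) (hq6 : q ≤ 6) (hq3 : q ≠ 3) : κ q = c q • cupPowTwo θ q :=
  hside q (h.1 q hq1 hq6) hq3

end Summit.HodgeConjecture.HodgeConjecture.Ring2.SemiregularRepresentatives

end
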